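import Literature.NumberTheory.Sieve.IwaniecAlmostPrimesQuadraticMertens

/-!
# Mertens II tails for a sieve density `ω(p)/p` from Mertens I with a bounded error — generic layer

Solo unit `solo-Parity-informed` (ideation tier, informed mode), session 13; `PLAN.md` §21, CLAIMS C57.

Generic (any `ω : ℕ → ℕ`) version of the first half of the tree's derivation of the one-sided sieve
condition for `ρ_G`, `G` quadratic (`Iwaniec1978.sum_Ioc_rhoG_div_le`, `sum_rhoG_div_filter_le`):

* `OmegaMertens.abs_omegaLogSum_sub_log_le` — integer form `|∑_{p ≤ Q} ω(p) log p/p - log Q| ≤ C`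
  (`Q ≥ 2`) to real form (`t ≥ 1`, constant `C + log 2`);
* `OmegaMertens.sum_Ioc_omega_div_le` — `∑_{P < p ≤ Q} ω(p)/p ≤ log log Q - log log P + 2C/log P`
  by Abel summation;
* `OmegaMertens.sum_omega_div_filter_le` — `∑_{w ≤ p < z} ω(p)/p ≤ log(log z/log w) + (5+12C)/log w`
  for `2 ≤ w < z`, given `ω(2) ≤ 1`.

The sieve condition itself (with the bound `ω(p) ≤ M`) and its instance for the root count `ρ_g` of
every Bateman–Horn polynomial are in `SoloInformedRootCountSieveCondition`.

References: H. Halberstam, H.-E. Richert, *Sieve Methods* (Academic Press 1974) Ch. 2; H. Iwaniec,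
Acta Arith. 37 (1980) 307–320, condition (1).
-/

open Finset Real Filter MeasureTheory Polynomial
open scoped Topology

noncomputable section

namespace Summit.Parity.BatemanHorn.Theorems

open Literature.NumberTheory.Sieve.Iwaniec1978 (primesBelow_filter_subset)

namespace OmegaMertens

variable {ω : ℕ → ℕ}

/-- `R_ω(t) = ∑_{p ≤ t} ω(p) log p / p`. -/
def omegaLogSum (ω : ℕ → ℕ) (t : ℝ) : ℝ :=
  ∑ p ∈ Nat.primesLE ⌊t⌋₊, (ω p : ℝ) * Real.log p / p

/-- The prime-indicator form of `R_ω(m)` used with Mathlib's Abel summation. -/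
theorem sum_Icc_ite_prime_omega_log_div (m : ℕ) :
    ∑ k ∈ Icc 0 m, (if k.Prime then (ω k : ℝ) * Real.log k / k else 0) =
      ∑ p ∈ Nat.primesLE m, (ω p : ℝ) * Real.log p / p := by
  rw [Nat.primesLE_eq_filter_range, Finset.sum_filter, Nat.range_succ_eq_Icc_zero]

/-- From the integer form `|R_ω(Q) - log Q| ≤ C` (`Q ≥ 2`) to the real form
`|R_ω(t) - log t| ≤ C + log 2` (`t ≥ 1`). -/
theorem abs_omegaLogSum_sub_log_le {C : ℝ}
    (hC : ∀ Q : ℕ, 2 ≤ Q →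
      |(∑ p ∈ Nat.primesLE Q, (ω p : ℝ) * Real.log p / p) - Real.log Q| ≤ C) :
    ∀ t : ℝ, 1 ≤ t → |omegaLogSum ω t - Real.log t| ≤ C + Real.log 2 := by
  have hC0 : 0 ≤ C := (abs_nonneg _).trans (hC 2 le_rfl)
  intro t ht
  have ht0 : 0 ≤ t := by linarith
  have hlogt : 0 ≤ Real.log t := Real.log_nonneg ht
  rcases Nat.lt_or_ge ⌊t⌋₊ 2 with h | h
  · -- `1 ≤ t < 2`: the sum is empty
    have hfl : ⌊t⌋₊ = 1 := by
      have h1 : 1 ≤ ⌊t⌋₊ := Nat.le_floor (by exact_mod_cast ht)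
      omega
    have ht2 : t < 2 := by
      have := Nat.lt_floor_add_one t
      rw [hfl] at this
      exact_mod_cast this
    have hsum : omegaLogSum ω t = 0 := by
      rw [omegaLogSum, hfl]
      refine Finset.sum_eq_zero fun p hp => ?_
      obtain ⟨hp1, hpp⟩ := Nat.mem_primesLE.mp hp
      exact absurd hp1 (by have := hpp.two_le; omega)
    rw [hsum, zero_sub, abs_neg, abs_of_nonneg hlogt]
    have : Real.log t ≤ Real.log 2 := Real.log_le_log (by linarith) ht2.le
    linarith
  · set Q := ⌊t⌋₊ with hQ
    have hQt : (Q : ℝ) ≤ t := Nat.floor_le ht0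
    have htQ : t < Q + 1 := Nat.lt_floor_add_one t
    have hQ0 : (0 : ℝ) < Q := by exact_mod_cast (show 0 < Q by omega)
    have h1 := hC Q h
    have h2 : |Real.log t - Real.log Q| ≤ Real.log 2 := by
      rw [← Real.log_div (by linarith) hQ0.ne', abs_of_nonneg (Real.log_nonneg (by
        rw [le_div_iff₀ hQ0]; linarith))]
      refine Real.log_le_log (by positivity) ?_
      rw [div_le_iff₀ hQ0]
      have : (1 : ℝ) ≤ Q := by exact_mod_cast (show 1 ≤ Q by omega)
      linarith
    rw [omegaLogSum]
    rw [abs_le] at h1 h2 ⊢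
    constructor <;> linarith [h1.1, h1.2, h2.1, h2.2]

/-- Tail upper bound: `∑_{P < p ≤ Q} ω(p)/p ≤ log log Q − log log P + 2C / log P` by Abel
summation from `|R_ω(t) - log t| ≤ C`. -/
theorem sum_Ioc_omega_div_le {C : ℝ} (hC : ∀ t : ℝ, 1 ≤ t → |omegaLogSum ω t - Real.log t| ≤ C)
    {P Q : ℝ} (hP : 2 ≤ P) (hPQ : P ≤ Q) :
    ∑ p ∈ (Ioc ⌊P⌋₊ ⌊Q⌋₊).filter Nat.Prime, (ω p : ℝ) / p ≤
      Real.log (Real.log Q) - Real.log (Real.log P) + 2 * C / Real.log P := by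
  have hP0 : (0 : ℝ) ≤ P := by linarith
  have hQ : 2 ≤ Q := hP.trans hPQ
  set cf : ℕ → ℝ := fun k => if k.Prime then (ω k : ℝ) * Real.log k / k else 0 with hcdef
  set f : ℝ → ℝ := fun t => (Real.log t)⁻¹ with hf
  set g : ℝ → ℝ := fun t => -t⁻¹ / Real.log t ^ 2 with hg
  have hderiv : ∀ t : ℝ, 1 < t → HasDerivAt f (g t) t := by
    intro t ht
    exact (Real.hasDerivAt_log (show t ≠ 0 by linarith)).inv (Real.log_pos ht).ne'
  have hmem : ∀ t ∈ Set.Icc P Q, t ∈ ({0}ᶜ : Set ℝ) := fun t ht =>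
    Set.mem_compl_singleton_iff.mpr (show (0 : ℝ) < t by linarith [ht.1]).ne'
  have hlogne : ∀ t ∈ Set.Icc P Q, Real.log t ≠ 0 := fun t ht =>
    (Real.log_pos (by linarith [ht.1])).ne'
  have hgcont : ContinuousOn g (Set.Icc P Q) :=
    ContinuousOn.div (ContinuousOn.neg (continuousOn_inv₀.mono hmem))
      ((Real.continuousOn_log.mono hmem).pow 2) fun t ht => pow_ne_zero _ (hlogne t ht)
  have hf_diff : ∀ t ∈ Set.Icc P Q, DifferentiableAt ℝ f t := fun t ht =>
    (hderiv t (by linarith [ht.1])).differentiableAt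
  have hderiv_eq : Set.EqOn g (deriv f) (Set.Icc P Q) := fun t ht =>
    ((hderiv t (by linarith [ht.1])).deriv).symm
  have hg_int : IntegrableOn g (Set.Icc P Q) := hgcont.integrableOn_Icc
  have hf_int : IntegrableOn (deriv f) (Set.Icc P Q) :=
    hg_int.congr_fun hderiv_eq measurableSet_Icc
  -- Abel summation
  have habel := sum_mul_eq_sub_sub_integral_mul cf hP0 hPQ hf_diff hf_int
  have hlhs : ∑ k ∈ Ioc ⌊P⌋₊ ⌊Q⌋₊, f k * cf k =
      ∑ p ∈ (Ioc ⌊P⌋₊ ⌊Q⌋₊).filter Nat.Prime, (ω p : ℝ) / p := by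
    rw [Finset.sum_filter]
    refine Finset.sum_congr rfl fun k _ => ?_
    simp only [hcdef]
    split_ifs with hk
    · have hk1 : (1 : ℝ) < k := by exact_mod_cast hk.one_lt
      have : Real.log k ≠ 0 := (Real.log_pos hk1).ne'
      show (Real.log k)⁻¹ * ((ω k : ℝ) * Real.log k / k) = (ω k : ℝ) / k
      field_simp
    · simp
  -- the partial sums
  have hS : ∀ t : ℝ, 1 ≤ t →
      Real.log t - C ≤ ∑ k ∈ Icc 0 ⌊t⌋₊, cf k ∧ ∑ k ∈ Icc 0 ⌊t⌋₊, cf k ≤ Real.log t + C := by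
    intro t ht
    rw [hcdef, sum_Icc_ite_prime_omega_log_div]
    have h := hC t ht
    rw [omegaLogSum, abs_le] at h
    constructor <;> linarith [h.1, h.2]
  have hlogP : 0 < Real.log P := Real.log_pos (by linarith)
  have hlogQ : 0 < Real.log Q := Real.log_pos (by linarith)
  -- boundary terms
  have hbQ : f Q * ∑ k ∈ Icc 0 ⌊Q⌋₊, cf k ≤ 1 + C / Real.log Q := by
    have := (hS Q (by linarith)).2
    calc f Q * ∑ k ∈ Icc 0 ⌊Q⌋₊, cf k ≤ (Real.log Q)⁻¹ * (Real.log Q + C) :=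
          mul_le_mul_of_nonneg_left this (inv_nonneg.mpr hlogQ.le)
      _ = 1 + C / Real.log Q := by field_simp
  have hbP : 1 - C / Real.log P ≤ f P * ∑ k ∈ Icc 0 ⌊P⌋₊, cf k := by
    have := (hS P (by linarith)).1
    calc 1 - C / Real.log P = (Real.log P)⁻¹ * (Real.log P - C) := by field_simp
      _ ≤ (Real.log P)⁻¹ * ∑ k ∈ Icc 0 ⌊P⌋₊, cf k :=
          mul_le_mul_of_nonneg_left this (inv_nonneg.mpr hlogP.le)
  -- the integral term
  have hint : -∫ t in Set.Ioc P Q, deriv f t * ∑ k ∈ Icc 0 ⌊t⌋₊, cf k ≤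
      Real.log (Real.log Q) - C / Real.log Q - (Real.log (Real.log P) - C / Real.log P) := by
    have h1 : ∫ t in Set.Ioc P Q, deriv f t * ∑ k ∈ Icc 0 ⌊t⌋₊, cf k =
        ∫ t in Set.Ioc P Q, g t * ∑ k ∈ Icc 0 ⌊t⌋₊, cf k := by
      refine setIntegral_congr_fun measurableSet_Ioc fun t ht => ?_
      rw [hderiv_eq (Set.Ioc_subset_Icc_self ht)]
    rw [h1, ← integral_neg]
    set F : ℝ → ℝ := fun t => Real.log (Real.log t) - C * (Real.log t)⁻¹ with hF
    set w : ℝ → ℝ := fun t => t⁻¹ / Real.log t ^ 2 * (Real.log t + C) with hw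
    have hFderiv : ∀ t : ℝ, 1 < t → HasDerivAt F (w t) t := by
      intro t ht
      have ht0 : t ≠ 0 := by linarith
      have hl : Real.log t ≠ 0 := (Real.log_pos ht).ne'
      have hA := (Real.hasDerivAt_log ht0).log hl
      have hB := ((Real.hasDerivAt_log ht0).inv hl).const_mul C
      have heq : t⁻¹ / Real.log t - C * (-t⁻¹ / Real.log t ^ 2) = w t := by
        simp only [hw]
        field_simp
        ring
      exact (hA.sub hB).congr_deriv heq
    have hwcont : ContinuousOn w (Set.Icc P Q) :=
      ContinuousOn.mul (ContinuousOn.div (continuousOn_inv₀.mono hmem)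
        ((Real.continuousOn_log.mono hmem).pow 2) fun t ht => pow_ne_zero _ (hlogne t ht))
        ((Real.continuousOn_log.mono hmem).add continuousOn_const)
    have hFTC : ∫ t in Set.Ioc P Q, w t = F Q - F P := by
      rw [← intervalIntegral.integral_of_le hPQ]
      refine intervalIntegral.integral_eq_sub_of_hasDerivAt (fun t ht => hFderiv t ?_)
        (hwcont.mono ?_).intervalIntegrable
      · rw [Set.uIcc_of_le hPQ] at ht; linarith [ht.1]
      · rw [Set.uIcc_of_le hPQ]
    have hFQP : F Q - F P =
        Real.log (Real.log Q) - C / Real.log Q - (Real.log (Real.log P) - C / Real.log P) := by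
      simp only [hF, div_eq_mul_inv]
    rw [← hFQP, ← hFTC]
    have hint1 : IntegrableOn w (Set.Ioc P Q) :=
      hwcont.integrableOn_Icc.mono_set Set.Ioc_subset_Icc_self
    have hint2 : IntegrableOn (fun t => -(g t * ∑ k ∈ Icc 0 ⌊t⌋₊, cf k)) (Set.Ioc P Q) :=
      ((integrableOn_mul_sum_Icc cf hP0 hg_int).mono_set Set.Ioc_subset_Icc_self).neg
    refine setIntegral_mono_on hint2 hint1 measurableSet_Ioc fun t ht => ?_
    have ht1 : 1 < t := by linarith [ht.1]
    have hpos : 0 ≤ t⁻¹ / Real.log t ^ 2 := by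
      have : 0 < t := by linarith
      positivity
    have := (hS t ht1.le).2
    calc -(g t * ∑ k ∈ Icc 0 ⌊t⌋₊, cf k) = t⁻¹ / Real.log t ^ 2 * ∑ k ∈ Icc 0 ⌊t⌋₊, cf k := by
          simp only [hg]; ring
      _ ≤ t⁻¹ / Real.log t ^ 2 * (Real.log t + C) := mul_le_mul_of_nonneg_left this hpos
      _ = w t := rfl
  rw [← hlhs, habel]
  have hCQ : 0 ≤ C / Real.log Q := by
    have h0 : 0 ≤ C := by
      have := hC 1 le_rfl
      exact (abs_nonneg _).trans this
    positivity
  have e1 : 2 * C / Real.log P = C / Real.log P + C / Real.log P := by ring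
  linarith

/-- `∑_{w ≤ p < z} ω(p)/p ≤ log(log z / log w) + (5 + 12C) / log w` for `2 ≤ w < z`
(uses `ω(2) ≤ 1`). -/
theorem sum_omega_div_filter_le (h2 : ω 2 ≤ 1)
    {C : ℝ} (hC : ∀ t : ℝ, 1 ≤ t → |omegaLogSum ω t - Real.log t| ≤ C)
    {w z : ℝ} (hw : 2 ≤ w) (hwz : w < z) :
    ∑ p ∈ (Nat.primesBelow ⌈z⌉₊).filter (fun p : ℕ => w ≤ (p : ℝ)), (ω p : ℝ) / p ≤
      Real.log (Real.log z / Real.log w) + (5 + 12 * C) / Real.log w := by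
  have hC0 : 0 ≤ C := by
    have := hC 1 le_rfl
    exact (abs_nonneg _).trans this
  have hz2 : 2 < z := by linarith
  have hlogw : 0 < Real.log w := Real.log_pos (by linarith)
  have hlogz : 0 < Real.log z := Real.log_pos (by linarith)
  have hnonneg : ∀ p ∈ (Ioc ⌊w - 1⌋₊ ⌊z⌋₊).filter Nat.Prime, (0 : ℝ) ≤ (ω p : ℝ) / p :=
    fun p _ => by positivity
  rw [Real.log_div hlogz.ne' hlogw.ne']
  by_cases h3 : 3 ≤ w
  · -- `w ≥ 3`: compare with the tail over `(w − 1, z]`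
    have hsub := primesBelow_filter_subset (z := z) (show (1 : ℝ) ≤ w by linarith)
    have h1 : (2 : ℝ) ≤ w - 1 := by linarith
    have hmain := sum_Ioc_omega_div_le hC h1 (by linarith : w - 1 ≤ z)
    have hle := (Finset.sum_le_sum_of_subset_of_nonneg hsub fun p hp _ => hnonneg p hp).trans hmain
    have hlw1 : 0 < Real.log (w - 1) := Real.log_pos (by linarith)
    have hA : Real.log (Real.log w) - Real.log (Real.log (w - 1)) ≤ (1 / 2) / Real.log (w - 1) := by
      rw [← Real.log_div hlogw.ne' hlw1.ne']
      have h := Real.log_le_sub_one_of_pos (div_pos hlogw hlw1)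
      have h2' : Real.log w / Real.log (w - 1) - 1 =
          (Real.log w - Real.log (w - 1)) / Real.log (w - 1) := by
        field_simp
      have h3' : Real.log w - Real.log (w - 1) ≤ 1 / 2 := by
        rw [← Real.log_div (by linarith) (by linarith)]
        have := Real.log_le_sub_one_of_pos (show 0 < w / (w - 1) by positivity)
        have h4 : w / (w - 1) - 1 = 1 / (w - 1) := by field_simp; ring
        rw [h4] at this
        calc Real.log (w / (w - 1)) ≤ 1 / (w - 1) := this
          _ ≤ 1 / 2 := by
            rw [div_le_div_iff₀ (by linarith) (by norm_num)]; linarith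
      calc Real.log (Real.log w / Real.log (w - 1)) ≤ Real.log w / Real.log (w - 1) - 1 := h
        _ = (Real.log w - Real.log (w - 1)) / Real.log (w - 1) := h2'
        _ ≤ (1 / 2) / Real.log (w - 1) := by gcongr
    have hB : 1 / Real.log (w - 1) ≤ 2 / Real.log w := by
      have h5 : Real.log w ≤ 2 * Real.log (w - 1) := by
        rw [← Real.log_rpow (by linarith), show ((w - 1) ^ (2 : ℝ)) = (w - 1) ^ 2 by norm_cast]
        exact Real.log_le_log (by linarith) (by nlinarith)
      rw [div_le_div_iff₀ hlw1 hlogw]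
      linarith
    have hB' : 0 < 1 / Real.log (w - 1) := by positivity
    calc ∑ p ∈ (Nat.primesBelow ⌈z⌉₊).filter (fun p : ℕ => w ≤ (p : ℝ)), (ω p : ℝ) / p
        ≤ Real.log (Real.log z) - Real.log (Real.log (w - 1)) + 2 * C / Real.log (w - 1) := hle
      _ ≤ Real.log (Real.log z) - Real.log (Real.log w) +
            (1 / 2 + 2 * C) * (1 / Real.log (w - 1)) := by
          have e1 : 2 * C / Real.log (w - 1) = 2 * C * (1 / Real.log (w - 1)) := by ring
          have e2 : 1 / 2 / Real.log (w - 1) = (1 / 2) * (1 / Real.log (w - 1)) := by ring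
          rw [e1] at hle; rw [e2] at hA
          nlinarith
      _ ≤ Real.log (Real.log z) - Real.log (Real.log w) + (1 / 2 + 2 * C) * (2 / Real.log w) := by
          gcongr
      _ ≤ Real.log (Real.log z) - Real.log (Real.log w) + (5 + 12 * C) / Real.log w := by
          rw [mul_div_assoc']
          gcongr
          linarith
  · -- `2 ≤ w < 3`: the whole range `2 ≤ p < z`
    push Not at h3
    have hfl2 : ⌊(2 : ℝ)⌋₊ = 2 := by norm_num
    have hsub : (Nat.primesBelow ⌈z⌉₊).filter (fun p : ℕ => w ≤ (p : ℝ)) ⊆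
        insert 2 ((Ioc ⌊(2 : ℝ)⌋₊ ⌊z⌋₊).filter Nat.Prime) := by
      intro p hp
      simp only [Finset.mem_filter, Nat.mem_primesBelow, Finset.mem_insert, Finset.mem_Ioc] at hp ⊢
      obtain ⟨⟨hpz, hpp⟩, hwp⟩ := hp
      rcases hpp.two_le.eq_or_lt with h | h
      · exact Or.inl h.symm
      · refine Or.inr ⟨⟨?_, ?_⟩, hpp⟩
        · rw [hfl2]; exact h
        · have := Nat.ceil_le_floor_add_one z; omega
    have hmain := sum_Ioc_omega_div_le hC (le_refl (2 : ℝ)) hz2.le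
    have h2notin : (2 : ℕ) ∉ (Ioc ⌊(2 : ℝ)⌋₊ ⌊z⌋₊).filter Nat.Prime := by
      rw [hfl2]; simp
    have hnonneg' : ∀ p ∈ insert 2 ((Ioc ⌊(2 : ℝ)⌋₊ ⌊z⌋₊).filter Nat.Prime),
        (0 : ℝ) ≤ (ω p : ℝ) / p := fun p _ => by positivity
    have hle : ∑ p ∈ (Nat.primesBelow ⌈z⌉₊).filter (fun p : ℕ => w ≤ (p : ℝ)), (ω p : ℝ) / p ≤
        1 / 2 + (Real.log (Real.log z) - Real.log (Real.log 2) + 2 * C / Real.log 2) := by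
      calc ∑ p ∈ (Nat.primesBelow ⌈z⌉₊).filter (fun p : ℕ => w ≤ (p : ℝ)), (ω p : ℝ) / p
          ≤ ∑ p ∈ insert 2 ((Ioc ⌊(2 : ℝ)⌋₊ ⌊z⌋₊).filter Nat.Prime), (ω p : ℝ) / p :=
            Finset.sum_le_sum_of_subset_of_nonneg hsub fun p hp _ => hnonneg' p hp
        _ = (ω 2 : ℝ) / 2 + ∑ p ∈ (Ioc ⌊(2 : ℝ)⌋₊ ⌊z⌋₊).filter Nat.Prime, (ω p : ℝ) / p := by
            rw [Finset.sum_insert h2notin]; norm_num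
        _ ≤ 1 / 2 + (Real.log (Real.log z) - Real.log (Real.log 2) + 2 * C / Real.log 2) := by
            have hρ2 : (ω 2 : ℝ) ≤ 1 := by exact_mod_cast h2
            linarith
    -- numerical facts
    have hlog2 : 1 / 2 < Real.log 2 := by have := Real.log_two_gt_d9; linarith
    have hlog2' : 0 < Real.log 2 := by linarith
    have hlog3 : 0 < Real.log 3 := Real.log_pos (by norm_num)
    have hlogw3 : Real.log w < Real.log 3 := Real.log_lt_log (by linarith) h3
    have hll : Real.log (Real.log w) < Real.log (Real.log 3) := Real.log_lt_log hlogw hlogw3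
    have h32 : Real.log (Real.log 3) - Real.log (Real.log 2) ≤ 2 := by
      rw [← Real.log_div hlog3.ne' hlog2'.ne']
      have h := Real.log_le_sub_one_of_pos (div_pos hlog3 hlog2')
      have h' : Real.log 3 / Real.log 2 ≤ 3 := by
        rw [div_le_iff₀ hlog2']
        have : Real.log 3 ≤ Real.log 8 := Real.log_le_log (by norm_num) (by norm_num)
        have h8 : Real.log 8 = 3 * Real.log 2 := by
          rw [show (8 : ℝ) = 2 ^ 3 by norm_num, Real.log_pow]; push_cast; ring
        linarith
      linarith
    have hlogw3' : Real.log w ≤ 2 := by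
      have := Real.log_le_sub_one_of_pos (show (0 : ℝ) < 3 by norm_num); linarith
    have hCw : (5 + 12 * C) / 2 ≤ (5 + 12 * C) / Real.log w := by
      apply div_le_div_of_nonneg_left (by linarith) hlogw
      linarith
    have hC2 : 2 * C / Real.log 2 ≤ 4 * C := by
      rw [div_le_iff₀ hlog2']; nlinarith
    linarith

end OmegaMertens

end Summit.Parity.BatemanHorn.Theorems

end
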